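import Summits.CriticalPhenomena.PercolationContinuityZ3.Theorems.PercNearOneGluingNoHeavyLowerTailTformLightStarInductionOpenChampion
import HarnessLib

/-!
# `NoHeavyLowerTail` (stmt-CriticalPhenomena-4575) — the light-star induction with the STRENGTHENED invariant S⁺ (every relay admissible up to its gap)

Support file (prover `prim-hp-5`, hull-port cell, T-form calculus, gen 9; `--supports stmt-CriticalPhenomena-4575`).  No definitions, no named
facts, no sorries.  `μ = prodBernoulli w`, relays `A`, level `j`, `π(x)` = relays joined to `x`, `π(B) = ⋃_{y∈B} π(y)`, champion `q`.
The invariant S⁺ (memo OBSERVER-SET.md §2 'SGH', §23) at a non-relay set `B`, fallback `c`, relay `x`: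
    S⁺(w, B, q, c, x):  `μ(1 ≤ |π(B)| ≤ j) + μ(|π(B)| = 0, |π(c)| ≤ j) + μ(x ~ B, |π(x)| ≤ j < |π(B)|) ≤ μ(|π(q)| ≤ j)`
(threshold of the glued observer + gluing damage of ANY relay ≤ champion lightness).  At `x = q` it is LSP(w, q, c, B) (`lsp_of_sPlus`), at
`B = {o}` it is XZ⁺.  `sPlus_induction_open` is `Theorems.lspSet_induction_open` run on S⁺: the singleton step is the same deficit star-packing
transfer (its star inputs are the induction hypothesis AT THE CHAMPION of `u = w − o`), every set with `2 ≤ |B|` is the hypothesis `hStep`,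
which RECEIVES S⁺ — admissibility up to the gap of EVERY relay — below.  Seat census of S⁺ (gen 9): 0 violations, tight on stars.
Corollaries (stub, crux): file `…TformSPlusInductionChampion`.
-/

noncomputable section

namespace Summit.CriticalPhenomena.PercolationContinuityZ3.Theorems

open MeasureTheory Set Literature.Probability.LatticeModels Literature.Probability.Percolation
open scoped Classical BigOperators

variable {n : ℕ}

/-- **S⁺ at the reference itself is LSP.**  If `μ(1 ≤ |π(S)| ≤ j) + μ(|π(S)| = 0, |π(c)| ≤ j) + μ(p ~ S, |π(p)| ≤ j < |π(S)|) ≤ μ(|π(p)| ≤ j)`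
for a relay `p`, then `μ(p ≁ S, 1 ≤ |π(S)| ≤ j) + μ(|π(S)| = 0, |π(c)| ≤ j) ≤ μ(p ≁ S, |π(p)| ≤ j)` (on `{p ~ S}` the events
`{|π(S)| ≤ j}` and `{|π(p)| ≤ j, |π(S)| ≤ j}` coincide and `|π(S)| ≥ 1`). [cite: KozmaNitzan2024, Lemma 5 (p. 13)] -/
theorem lsp_of_sPlus (w : Sym2 (Fin n) → unitInterval) (A S : Finset (Fin n)) (p c : Fin n) (j : ℕ) (hpA : p ∈ A)
    (h : (prodBernoulli w).real {ω : BondConfig (Fin n) | 1 ≤ (A.filter fun z => ∃ y ∈ S, ω ∈ openConn y z).card ∧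
          (A.filter fun z => ∃ y ∈ S, ω ∈ openConn y z).card ≤ j} +
        (prodBernoulli w).real {ω : BondConfig (Fin n) | ¬ 1 ≤ (A.filter fun z => ∃ y ∈ S, ω ∈ openConn y z).card ∧
          (A.filter fun z => ω ∈ openConn c z).card ≤ j} +
        (prodBernoulli w).real {ω : BondConfig (Fin n) | (∃ y ∈ S, ω ∈ openConn p y) ∧ (A.filter fun z => ω ∈ openConn p z).card ≤ j ∧
          ¬ (A.filter fun z => ∃ y ∈ S, ω ∈ openConn y z).card ≤ j} ≤
      (prodBernoulli w).real {ω : BondConfig (Fin n) | (A.filter fun z => ω ∈ openConn p z).card ≤ j}) :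
    (prodBernoulli w).real {ω : BondConfig (Fin n) | (∀ y ∈ S, ω ∉ openConn p y) ∧
        1 ≤ (A.filter fun z => ∃ y ∈ S, ω ∈ openConn y z).card ∧ (A.filter fun z => ∃ y ∈ S, ω ∈ openConn y z).card ≤ j} +
      (prodBernoulli w).real {ω : BondConfig (Fin n) | ¬ 1 ≤ (A.filter fun z => ∃ y ∈ S, ω ∈ openConn y z).card ∧
        (A.filter fun z => ω ∈ openConn c z).card ≤ j} ≤
      (prodBernoulli w).real {ω : BondConfig (Fin n) | (∀ y ∈ S, ω ∉ openConn p y) ∧ (A.filter fun z => ω ∈ openConn p z).card ≤ j} := by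
  haveI : IsProbabilityMeasure (prodBernoulli w) := inferInstance
  set μ := prodBernoulli w with hμ
  set NS : BondConfig (Fin n) → ℕ := fun ω => (A.filter fun z => ∃ y ∈ S, ω ∈ openConn y z).card with hNS
  set Nx : Fin n → BondConfig (Fin n) → ℕ := fun x ω => (A.filter fun z => ω ∈ openConn x z).card with hNx
  set T : Set (BondConfig (Fin n)) := {ω | ∃ y ∈ S, ω ∈ openConn p y} with hT
  change μ.real {ω | 1 ≤ NS ω ∧ NS ω ≤ j} + μ.real {ω | ¬ 1 ≤ NS ω ∧ Nx c ω ≤ j} + μ.real {ω | ω ∈ T ∧ Nx p ω ≤ j ∧ ¬ NS ω ≤ j} ≤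
    μ.real {ω | Nx p ω ≤ j} at h
  change μ.real {ω | (∀ y ∈ S, ω ∉ openConn p y) ∧ 1 ≤ NS ω ∧ NS ω ≤ j} + μ.real {ω | ¬ 1 ≤ NS ω ∧ Nx c ω ≤ j} ≤
    μ.real {ω | (∀ y ∈ S, ω ∉ openConn p y) ∧ Nx p ω ≤ j}
  -- on `T = {p ~ S}`: `1 ≤ |π(S)|` and `|π(p)| ≤ |π(S)|`
  have hT1 : ∀ ω ∈ T, 1 ≤ NS ω := by
    rintro ω ⟨y, hy, hpy⟩
    exact Finset.card_pos.2 ⟨p, Finset.mem_filter.2 ⟨hpA, y, hy, (show (openGraph ω).Reachable p y from hpy).symm⟩⟩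
  have hTle : ∀ ω ∈ T, Nx p ω ≤ NS ω := by
    rintro ω ⟨y, hy, hpy⟩
    refine Finset.card_le_card fun z hz => ?_
    rw [Finset.mem_filter] at hz ⊢
    refine ⟨hz.1, y, hy, ?_⟩
    exact (show (openGraph ω).Reachable y z from (show (openGraph ω).Reachable p y from hpy).symm.trans hz.2)
  have hnotT : ∀ ω, ω ∉ T ↔ ∀ y ∈ S, ω ∉ openConn p y := fun ω => by simp only [hT, mem_setOf_eq, not_exists, not_and]
  -- split the three events along `T`
  have hs1 := measureReal_inter_add_sdiff (μ := μ) (s := {ω : BondConfig (Fin n) | 1 ≤ NS ω ∧ NS ω ≤ j})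
    (MeasurableSet.of_discrete (s := T)) (measure_ne_top _ _)
  have hs2 := measureReal_inter_add_sdiff (μ := μ) (s := {ω : BondConfig (Fin n) | Nx p ω ≤ j})
    (MeasurableSet.of_discrete (s := T)) (measure_ne_top _ _)
  have hs3 := measureReal_inter_add_sdiff (μ := μ) (s := {ω : BondConfig (Fin n) | Nx p ω ≤ j} ∩ T)
    (MeasurableSet.of_discrete (s := {ω : BondConfig (Fin n) | NS ω ≤ j})) (measure_ne_top _ _)
  have e1 : {ω : BondConfig (Fin n) | 1 ≤ NS ω ∧ NS ω ≤ j} \ T = {ω | (∀ y ∈ S, ω ∉ openConn p y) ∧ 1 ≤ NS ω ∧ NS ω ≤ j} := by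
    ext ω; simp only [mem_sdiff, mem_setOf_eq, hnotT]; tauto
  have e2 : {ω : BondConfig (Fin n) | Nx p ω ≤ j} \ T = {ω | (∀ y ∈ S, ω ∉ openConn p y) ∧ Nx p ω ≤ j} := by
    ext ω; simp only [mem_sdiff, mem_setOf_eq, hnotT]; tauto
  have e3 : ({ω : BondConfig (Fin n) | Nx p ω ≤ j} ∩ T) ∩ {ω | NS ω ≤ j} = {ω : BondConfig (Fin n) | 1 ≤ NS ω ∧ NS ω ≤ j} ∩ T := by
    ext ω
    simp only [mem_inter_iff, mem_setOf_eq]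
    constructor
    · rintro ⟨⟨_, hT'⟩, hS⟩; exact ⟨⟨hT1 ω hT', hS⟩, hT'⟩
    · rintro ⟨⟨_, hS⟩, hT'⟩; exact ⟨⟨le_trans (hTle ω hT') hS, hT'⟩, hS⟩
  have e4 : ({ω : BondConfig (Fin n) | Nx p ω ≤ j} ∩ T) \ {ω | NS ω ≤ j} = {ω | ω ∈ T ∧ Nx p ω ≤ j ∧ ¬ NS ω ≤ j} := by
    ext ω; simp only [mem_sdiff, mem_inter_iff, mem_setOf_eq]; tauto
  rw [e1] at hs1; rw [e2] at hs2; rw [e3, e4] at hs3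
  linarith


open CutObserver KNPreFKG in
/-- **THE LIGHT-STAR INDUCTION WITH THE INVARIANT S⁺ (open recursion).**  Let `C` be a class of weighted relay-graphs closed under
deleting the pairs at a vertex.  Assume the STEP on `C`: for `w ∈ C`, a champion `q`, relays `c, x` and a set `B` of at least two
non-relay vertices, S⁺(w, B, q, c, x) holds — GIVEN S⁺ (at every champion, every fallback and EVERY relay) for every nonempty non-relay
set of every graph of `C` with fewer positive pairs, and for every smaller set of every graph of `C` with at most as many positive pairs.
Then S⁺(w, B, q, c, x) holds for every `w ∈ C`, champion `q`, relays `c, x` and nonempty non-relay set `B`.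
[cite: VandenbergHaggstromKahn2005, Thm. 1.5 (p. 7); KozmaNitzan2024, Lemma 5 (p. 13)] -/
theorem sPlus_induction_open
    (C : (n : ℕ) → (Sym2 (Fin n) → unitInterval) → Finset (Fin n) → Prop)
    (hC : ∀ (n : ℕ) (w : Sym2 (Fin n) → unitInterval) (A : Finset (Fin n)) (o : Fin n),
      C n w A → C n (fun e => if e ∈ {e : Sym2 (Fin n) | o ∉ e} then w e else 0) A)
    (hStep : ∀ (n : ℕ) (w : Sym2 (Fin n) → unitInterval) (A B : Finset (Fin n)) (q c x : Fin n) (j : ℕ), C n w A →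
      (∀ (n' : ℕ) (w' : Sym2 (Fin n') → unitInterval) (A' B' : Finset (Fin n')) (q' c' x' : Fin n') (j' : ℕ),
        ((Finset.univ.filter fun e : Sym2 (Fin n') => w' e ≠ 0).card < (Finset.univ.filter fun e : Sym2 (Fin n) => w e ≠ 0).card ∨
          ((Finset.univ.filter fun e : Sym2 (Fin n') => w' e ≠ 0).card ≤ (Finset.univ.filter fun e : Sym2 (Fin n) => w e ≠ 0).card ∧ B'.card < B.card)) →
        C n' w' A' → q' ∈ A' → c' ∈ A' → x' ∈ A' → B'.Nonempty → (∀ y ∈ B', y ∉ A') →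
        (∀ a ∈ A', (prodBernoulli w').real {ω : BondConfig (Fin n') | (A'.filter fun x => ω ∈ openConn a x).card ≤ j'} ≤
          (prodBernoulli w').real {ω : BondConfig (Fin n') | (A'.filter fun x => ω ∈ openConn q' x).card ≤ j'}) →
        (prodBernoulli w').real {ω : BondConfig (Fin n') | 1 ≤ (A'.filter fun z => ∃ y ∈ B', ω ∈ openConn y z).card ∧
            (A'.filter fun z => ∃ y ∈ B', ω ∈ openConn y z).card ≤ j'} +
          (prodBernoulli w').real {ω : BondConfig (Fin n') | ¬ 1 ≤ (A'.filter fun z => ∃ y ∈ B', ω ∈ openConn y z).card ∧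
            (A'.filter fun z => ω ∈ openConn c' z).card ≤ j'} +
          (prodBernoulli w').real {ω : BondConfig (Fin n') | (∃ y ∈ B', ω ∈ openConn x' y) ∧ (A'.filter fun z => ω ∈ openConn x' z).card ≤ j' ∧
            ¬ (A'.filter fun z => ∃ y ∈ B', ω ∈ openConn y z).card ≤ j'} ≤
        (prodBernoulli w').real {ω : BondConfig (Fin n') | (A'.filter fun z => ω ∈ openConn q' z).card ≤ j'}) →
      q ∈ A → c ∈ A → x ∈ A → 2 ≤ B.card → (∀ y ∈ B, y ∉ A) →
      (∀ a ∈ A, (prodBernoulli w).real {ω : BondConfig (Fin n) | (A.filter fun x => ω ∈ openConn a x).card ≤ j} ≤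
          (prodBernoulli w).real {ω : BondConfig (Fin n) | (A.filter fun x => ω ∈ openConn q x).card ≤ j}) →
      (prodBernoulli w).real {ω : BondConfig (Fin n) | 1 ≤ (A.filter fun z => ∃ y ∈ B, ω ∈ openConn y z).card ∧
            (A.filter fun z => ∃ y ∈ B, ω ∈ openConn y z).card ≤ j} +
          (prodBernoulli w).real {ω : BondConfig (Fin n) | ¬ 1 ≤ (A.filter fun z => ∃ y ∈ B, ω ∈ openConn y z).card ∧
            (A.filter fun z => ω ∈ openConn c z).card ≤ j} +
          (prodBernoulli w).real {ω : BondConfig (Fin n) | (∃ y ∈ B, ω ∈ openConn x y) ∧ (A.filter fun z => ω ∈ openConn x z).card ≤ j ∧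
            ¬ (A.filter fun z => ∃ y ∈ B, ω ∈ openConn y z).card ≤ j} ≤
        (prodBernoulli w).real {ω : BondConfig (Fin n) | (A.filter fun z => ω ∈ openConn q z).card ≤ j}) :
    ∀ (m b : ℕ) (n : ℕ) (w : Sym2 (Fin n) → unitInterval) (A B : Finset (Fin n)) (q c x : Fin n) (j : ℕ),
      (Finset.univ.filter fun e : Sym2 (Fin n) => w e ≠ 0).card ≤ m → B.card ≤ b → C n w A → q ∈ A → c ∈ A → x ∈ A → B.Nonempty → (∀ y ∈ B, y ∉ A) →
      (∀ a ∈ A, (prodBernoulli w).real {ω : BondConfig (Fin n) | (A.filter fun x => ω ∈ openConn a x).card ≤ j} ≤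
          (prodBernoulli w).real {ω : BondConfig (Fin n) | (A.filter fun x => ω ∈ openConn q x).card ≤ j}) →
      (prodBernoulli w).real {ω : BondConfig (Fin n) | 1 ≤ (A.filter fun z => ∃ y ∈ B, ω ∈ openConn y z).card ∧
            (A.filter fun z => ∃ y ∈ B, ω ∈ openConn y z).card ≤ j} +
          (prodBernoulli w).real {ω : BondConfig (Fin n) | ¬ 1 ≤ (A.filter fun z => ∃ y ∈ B, ω ∈ openConn y z).card ∧
            (A.filter fun z => ω ∈ openConn c z).card ≤ j} +
          (prodBernoulli w).real {ω : BondConfig (Fin n) | (∃ y ∈ B, ω ∈ openConn x y) ∧ (A.filter fun z => ω ∈ openConn x z).card ≤ j ∧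
            ¬ (A.filter fun z => ∃ y ∈ B, ω ∈ openConn y z).card ≤ j} ≤
        (prodBernoulli w).real {ω : BondConfig (Fin n) | (A.filter fun z => ω ∈ openConn q z).card ≤ j} := by
  intro m
  induction m with
  | zero =>
    intro b
    induction b with
    | zero =>
      intro n w A B q c x j hm hb hCw hq hc hx hBne hBA hchamp
      exact absurd (Finset.card_pos.2 hBne) (by omega)
    | succ b ihb =>
      intro n w A B q c x j hm hb hCw hq hc hx hBne hBA hchamp
      exact step n w A B q c x j hCw hq hc hx hBne hBA hchamp
        (fun n' w' A' B' q' c' x' j' hlt => by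
          rcases hlt with hlt | ⟨hle, hcard⟩
          · exact absurd hlt (by omega)
          · exact ihb n' w' A' B' q' c' x' j' (by omega) (by omega))
  | succ m ihm =>
    intro b
    induction b with
    | zero =>
      intro n w A B q c x j hm hb hCw hq hc hx hBne hBA hchamp
      exact absurd (Finset.card_pos.2 hBne) (by omega)
    | succ b ihb =>
      intro n w A B q c x j hm hb hCw hq hc hx hBne hBA hchamp
      exact step n w A B q c x j hCw hq hc hx hBne hBA hchamp
        (fun n' w' A' B' q' c' x' j' hlt => by
          rcases hlt with hlt | ⟨hle, hcard⟩
          · exact ihm B'.card n' w' A' B' q' c' x' j' (by omega) le_rfl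
          · exact ihb n' w' A' B' q' c' x' j' (by omega) (by omega))
  where
  /- the induction step, with the induction hypothesis available for every graph with FEWER positive pairs (any set) and for
  every SMALLER set in graphs with at most as many positive pairs -/
  step (n : ℕ) (w : Sym2 (Fin n) → unitInterval) (A B : Finset (Fin n)) (q c x : Fin n) (j : ℕ)
      (hCw : C n w A) (hq : q ∈ A) (hc : c ∈ A) (hx : x ∈ A) (hBne : B.Nonempty) (hBA : ∀ y ∈ B, y ∉ A)
      (hchamp : (∀ a ∈ A, (prodBernoulli w).real {ω : BondConfig (Fin n) | (A.filter fun x => ω ∈ openConn a x).card ≤ j} ≤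
          (prodBernoulli w).real {ω : BondConfig (Fin n) | (A.filter fun x => ω ∈ openConn q x).card ≤ j}))
      (ih : (∀ (n' : ℕ) (w' : Sym2 (Fin n') → unitInterval) (A' B' : Finset (Fin n')) (q' c' x' : Fin n') (j' : ℕ),
        ((Finset.univ.filter fun e : Sym2 (Fin n') => w' e ≠ 0).card < (Finset.univ.filter fun e : Sym2 (Fin n) => w e ≠ 0).card ∨
          ((Finset.univ.filter fun e : Sym2 (Fin n') => w' e ≠ 0).card ≤ (Finset.univ.filter fun e : Sym2 (Fin n) => w e ≠ 0).card ∧ B'.card < B.card)) →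
        C n' w' A' → q' ∈ A' → c' ∈ A' → x' ∈ A' → B'.Nonempty → (∀ y ∈ B', y ∉ A') →
        (∀ a ∈ A', (prodBernoulli w').real {ω : BondConfig (Fin n') | (A'.filter fun x => ω ∈ openConn a x).card ≤ j'} ≤
          (prodBernoulli w').real {ω : BondConfig (Fin n') | (A'.filter fun x => ω ∈ openConn q' x).card ≤ j'}) →
        (prodBernoulli w').real {ω : BondConfig (Fin n') | 1 ≤ (A'.filter fun z => ∃ y ∈ B', ω ∈ openConn y z).card ∧
            (A'.filter fun z => ∃ y ∈ B', ω ∈ openConn y z).card ≤ j'} +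
          (prodBernoulli w').real {ω : BondConfig (Fin n') | ¬ 1 ≤ (A'.filter fun z => ∃ y ∈ B', ω ∈ openConn y z).card ∧
            (A'.filter fun z => ω ∈ openConn c' z).card ≤ j'} +
          (prodBernoulli w').real {ω : BondConfig (Fin n') | (∃ y ∈ B', ω ∈ openConn x' y) ∧ (A'.filter fun z => ω ∈ openConn x' z).card ≤ j' ∧
            ¬ (A'.filter fun z => ∃ y ∈ B', ω ∈ openConn y z).card ≤ j'} ≤
        (prodBernoulli w').real {ω : BondConfig (Fin n') | (A'.filter fun z => ω ∈ openConn q' z).card ≤ j'})) :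
      (prodBernoulli w).real {ω : BondConfig (Fin n) | 1 ≤ (A.filter fun z => ∃ y ∈ B, ω ∈ openConn y z).card ∧
            (A.filter fun z => ∃ y ∈ B, ω ∈ openConn y z).card ≤ j} +
          (prodBernoulli w).real {ω : BondConfig (Fin n) | ¬ 1 ≤ (A.filter fun z => ∃ y ∈ B, ω ∈ openConn y z).card ∧
            (A.filter fun z => ω ∈ openConn c z).card ≤ j} +
          (prodBernoulli w).real {ω : BondConfig (Fin n) | (∃ y ∈ B, ω ∈ openConn x y) ∧ (A.filter fun z => ω ∈ openConn x z).card ≤ j ∧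
            ¬ (A.filter fun z => ∃ y ∈ B, ω ∈ openConn y z).card ≤ j} ≤
        (prodBernoulli w).real {ω : BondConfig (Fin n) | (A.filter fun z => ω ∈ openConn q z).card ≤ j} := by
    haveI : IsProbabilityMeasure (prodBernoulli w) := inferInstance
    set μ := prodBernoulli w with hμ
    -- notation for the `w`-counts
    set NB : BondConfig (Fin n) → ℕ := fun ω => (A.filter fun z => ∃ y ∈ B, ω ∈ openConn y z).card with hNB
    set Nx : Fin n → BondConfig (Fin n) → ℕ := fun x ω => (A.filter fun z => ω ∈ openConn x z).card with hNx
    change μ.real {ω | 1 ≤ NB ω ∧ NB ω ≤ j} + μ.real {ω | ¬ 1 ≤ NB ω ∧ Nx c ω ≤ j} +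
        μ.real {ω | (∃ y ∈ B, ω ∈ openConn x y) ∧ Nx x ω ≤ j ∧ ¬ NB ω ≤ j} ≤ μ.real {ω | Nx q ω ≤ j}
    have hfilt : ∀ (x : Fin n) (ξ : BondConfig (Fin n)), (A.filter fun z => (openGraph ξ).Reachable x z) = (A.filter fun z => ξ ∈ openConn x z) :=
      fun x ξ => Finset.filter_congr fun _ _ => Iff.rfl
    by_cases hcard : 2 ≤ B.card
    · -- #### a MULTI-SET: the step hypothesis (with the full induction hypothesis)
      exact hStep n w A B q c x j hCw ih hq hc hx hcard hBA hchamp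
    -- #### a SINGLETON `B = {o}`: the deficit star-packing transfer at the observer `o`
    obtain ⟨o, hoB⟩ := hBne
    have hB1 : B = {o} := by
      have hc1 : B.card = 1 := by have := Finset.card_pos.2 ⟨o, hoB⟩; omega
      obtain ⟨o', ho'⟩ := Finset.card_eq_one.1 hc1
      rw [ho'] at hoB ⊢; rw [Finset.mem_singleton.1 hoB]
    subst hB1
    have ho : o ∉ A := hBA o hoB
    -- `|π({o})| = |π(o)|`
    have hNo : ∀ ω, NB ω = Nx o ω := by
      intro ω
      simp only [hNB, hNx]; congr 1
      refine Finset.filter_congr fun z _ => ⟨fun ⟨x, hx, hxz⟩ => ?_, fun h => ⟨o, Finset.mem_singleton_self o, h⟩⟩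
      rw [Finset.mem_singleton.1 hx] at hxz; exact hxz
    -- the damage term vanishes for a singleton: `x ~ o` forces `|π(x)| = |π(o)|`
    have hgain0 : μ.real {ω | (∃ y ∈ ({o} : Finset (Fin n)), ω ∈ openConn x y) ∧ Nx x ω ≤ j ∧ ¬ NB ω ≤ j} = 0 := by
      have : {ω | (∃ y ∈ ({o} : Finset (Fin n)), ω ∈ openConn x y) ∧ Nx x ω ≤ j ∧ ¬ NB ω ≤ j} = (∅ : Set (BondConfig (Fin n))) := by
        ext ω
        simp only [mem_setOf_eq, mem_empty_iff_false, iff_false, not_and, not_not, Finset.mem_singleton, exists_eq_left]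
        intro hxo hxj
        have hxo' : (openGraph ω).Reachable x o := hxo
        have heq : Nx x ω = Nx o ω := by
          simp only [hNx]; congr 1
          refine Finset.filter_congr fun z _ => ⟨fun h => ?_, fun h => ?_⟩
          · exact (show (openGraph ω).Reachable o z from hxo'.symm.trans h)
          · exact (show (openGraph ω).Reachable x z from hxo'.trans h)
        rw [hNo ω, ← heq]; exact hxj
      rw [this, measureReal_empty]
    rw [hgain0, add_zero]
    -- ### the unrestricted deficit form `μ(1 ≤ N ≤ j) + Φ(c) ≤ μ(Φ_c ∩ 𝔸) + Φ(q)` (the step of `xzDeficit_induction_open`)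
    have hXZ : μ.real {ω : BondConfig (Fin n) | 1 ≤ Nx o ω ∧ Nx o ω ≤ j} + μ.real {ω : BondConfig (Fin n) | Nx c ω ≤ j} ≤
        μ.real {ω : BondConfig (Fin n) | Nx c ω ≤ j ∧ 1 ≤ Nx o ω} + μ.real {ω : BondConfig (Fin n) | Nx q ω ≤ j} := by
      set L := {ω : BondConfig (Fin n) | 1 ≤ Nx o ω ∧ Nx o ω ≤ j} with hL
      set RcA := {ω : BondConfig (Fin n) | Nx c ω ≤ j ∧ 1 ≤ Nx o ω} with hRcA
      set sW : Fin n → ℝ := fun y => μ.real {ω : BondConfig (Fin n) | (A.filter fun z => (openGraph (ω ∩ {e | o ∉ e})).Reachable y z).card ≤ j} with hsW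
      set Γ : Finset (Fin n) := Finset.univ.filter fun v => v ≠ o ∧ w s(o, v) ≠ 0 with hΓ
      have hΓo : o ∉ Γ := by
        rw [hΓ, Finset.mem_filter]; exact fun h => h.2.1 rfl
      have hiso : ∀ v, v ≠ o → v ∉ Γ → w s(o, v) = 0 := by
        intro v hvo hvΓ
        by_contra hne
        exact hvΓ (Finset.mem_filter.2 ⟨Finset.mem_univ _, hvo, hne⟩)
      by_cases hΓe : Γ = ∅
      · -- #### no gate: `L` is null
        have hdecL := real_eq_sum_inter_starEvent w Γ o hΓo hiso L
        rw [hΓe, Finset.powerset_empty, Finset.sum_singleton] at hdecL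
        have h0 : L ∩ starEvent o ↑(∅ : Finset (Fin n)) = (∅ : Set (BondConfig (Fin n))) := by
          ext ω
          simp only [mem_inter_iff, mem_empty_iff_false, iff_false, not_and]
          intro hLω hσ
          rw [Finset.coe_empty] at hσ
          obtain ⟨x, hx⟩ := Finset.card_pos.1 (lt_of_lt_of_le Nat.zero_lt_one hLω.1)
          rw [Finset.mem_filter] at hx
          exact not_reachable_of_mem_starEvent_empty hσ (fun h => ho (h ▸ hx.1)) hx.2
        rw [h0, measureReal_empty] at hdecL
        have hRcA0 : 0 ≤ μ.real RcA := measureReal_nonneg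
        rw [hdecL]
        linarith [hchamp c hc]
      -- #### a gate exists: the weights `u` without the pairs at `o` have fewer positive pairs
      obtain ⟨y₀, hy₀⟩ := Finset.nonempty_iff_ne_empty.2 hΓe
      have hy₀' := Finset.mem_filter.1 hy₀
      set u : Sym2 (Fin n) → unitInterval := fun e => if e ∈ {e : Sym2 (Fin n) | o ∉ e} then w e else 0 with hu
      have hCu : C n u A := hC n w A o hCw
      have hlt : (Finset.univ.filter fun e : Sym2 (Fin n) => u e ≠ 0).card < (Finset.univ.filter fun e : Sym2 (Fin n) => w e ≠ 0).card := by
        refine Finset.card_lt_card ⟨fun e he => ?_, fun hsub => ?_⟩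
        · rw [Finset.mem_filter] at he ⊢
          refine ⟨he.1, fun hwe => he.2 ?_⟩
          simp only [hu, mem_setOf_eq]
          split_ifs <;> simp [hwe]
        · have hmem : s(o, y₀) ∈ (Finset.univ.filter fun e : Sym2 (Fin n) => w e ≠ 0) :=
            Finset.mem_filter.2 ⟨Finset.mem_univ _, hy₀'.2.2⟩
          have := Finset.mem_filter.1 (hsub hmem)
          apply this.2
          simp only [hu, mem_setOf_eq, Sym2.mem_iff, true_or, not_true_eq_false, if_false]
      -- transfer of `K`-events to `prodBernoulli u`
      have e1 : ∀ x : Fin n, {ω : BondConfig (Fin n) | (A.filter fun z => (openGraph (ω ∩ {e | o ∉ e})).Reachable x z).card ≤ j} =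
          {ω : BondConfig (Fin n) | ω ∩ {e | o ∉ e} ∈ {ξ : BondConfig (Fin n) | (A.filter fun z => (openGraph ξ).Reachable x z).card ≤ j}} := fun x => rfl
      have eoc : ∀ (x : Fin n), {ξ : BondConfig (Fin n) | (A.filter fun z => (openGraph ξ).Reachable x z).card ≤ j} =
          {ξ : BondConfig (Fin n) | (A.filter fun z => ξ ∈ openConn x z).card ≤ j} := by
        intro x; ext ξ
        exact ⟨fun h => by rw [mem_setOf_eq] at h ⊢; rwa [← hfilt x ξ], fun h => by rw [mem_setOf_eq] at h ⊢; rwa [hfilt x ξ]⟩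
      -- a champion `p` of `u`
      obtain ⟨p, hpA, hpmax⟩ := Finset.exists_max_image A sW ⟨q, hq⟩
      have hchampK : ∀ a ∈ A, (prodBernoulli u).real {ξ : BondConfig (Fin n) | (A.filter fun z => (openGraph ξ).Reachable a z).card ≤ j} ≤
            (prodBernoulli u).real {ξ : BondConfig (Fin n) | (A.filter fun z => (openGraph ξ).Reachable p z).card ≤ j} := by
        intro a ha
        have h := hpmax a ha
        simp only [hsW] at h
        rw [e1 a, e1 p, measureReal_preimage_avoid, measureReal_preimage_avoid] at h
        exact h
      have hchampK' : ∀ a ∈ A, (prodBernoulli u).real {ξ : BondConfig (Fin n) | (A.filter fun z => ξ ∈ openConn a z).card ≤ j} ≤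
            (prodBernoulli u).real {ξ : BondConfig (Fin n) | (A.filter fun z => ξ ∈ openConn p z).card ≤ j} := by
        intro a ha; rw [← eoc a, ← eoc p]; exact hchampK a ha
      -- ### the deficit star-packing transfer with reference `p`
      have hmain := starPacking_deficit w A o p c j ho hpA hc ?_ (hpmax c hc)
      · have hgoal : μ.real {ω : BondConfig (Fin n) | 1 ≤ (A.filter fun x => ω ∈ openConn o x).card ∧ (A.filter fun x => ω ∈ openConn o x).card ≤ j} +
            μ.real {ω : BondConfig (Fin n) | (A.filter fun z => ω ∈ openConn c z).card ≤ j} ≤ μ.real {ω : BondConfig (Fin n) |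
              (A.filter fun x => ω ∈ openConn c x).card ≤ j ∧ 1 ≤ (A.filter fun x => ω ∈ openConn o x).card} +
            μ.real {ω : BondConfig (Fin n) | (A.filter fun z => ω ∈ openConn q z).card ≤ j} :=
          le_trans hmain (by linarith [hchamp p hpA])
        exact hgoal
      -- ### the packing inequality at every nonempty star: the induction hypothesis in `u` (any star size)
      intro S hSne hS
      have eP1 : {ω : BondConfig (Fin n) | (∀ y ∈ S, ¬ (openGraph (ω ∩ {e | o ∉ e})).Reachable p y) ∧
              1 ≤ (A.filter fun z => ∃ y ∈ S, (openGraph (ω ∩ {e | o ∉ e})).Reachable y z).card ∧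
              (A.filter fun z => ∃ y ∈ S, (openGraph (ω ∩ {e | o ∉ e})).Reachable y z).card ≤ j} =
          {ω : BondConfig (Fin n) | ω ∩ {e | o ∉ e} ∈ {ξ : BondConfig (Fin n) | (∀ y ∈ S, ¬ (openGraph ξ).Reachable p y) ∧
              1 ≤ (A.filter fun z => ∃ y ∈ S, (openGraph ξ).Reachable y z).card ∧ (A.filter fun z => ∃ y ∈ S, (openGraph ξ).Reachable y z).card ≤ j}} := rfl
      have eP2 : {ω : BondConfig (Fin n) | ¬ 1 ≤ (A.filter fun z => ∃ y ∈ S, (openGraph (ω ∩ {e | o ∉ e})).Reachable y z).card ∧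
              (A.filter fun z => (openGraph (ω ∩ {e | o ∉ e})).Reachable c z).card ≤ j} =
          {ω : BondConfig (Fin n) | ω ∩ {e | o ∉ e} ∈ {ξ : BondConfig (Fin n) |
            ¬ 1 ≤ (A.filter fun z => ∃ y ∈ S, (openGraph ξ).Reachable y z).card ∧ (A.filter fun z => (openGraph ξ).Reachable c z).card ≤ j}} := rfl
      have eP3 : {ω : BondConfig (Fin n) | (∀ y ∈ S, ¬ (openGraph (ω ∩ {e | o ∉ e})).Reachable p y) ∧
              (A.filter fun z => (openGraph (ω ∩ {e | o ∉ e})).Reachable p z).card ≤ j} =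
          {ω : BondConfig (Fin n) | ω ∩ {e | o ∉ e} ∈ {ξ : BondConfig (Fin n) | (∀ y ∈ S, ¬ (openGraph ξ).Reachable p y) ∧
              (A.filter fun z => (openGraph ξ).Reachable p z).card ≤ j}} := rfl
      rw [eP1, eP2, eP3, measureReal_preimage_avoid, measureReal_preimage_avoid, measureReal_preimage_avoid]
      set ν := prodBernoulli u with hν
      haveI : IsProbabilityMeasure ν := inferInstance
      set MS : BondConfig (Fin n) → ℕ := fun ξ => (A.filter fun z => ∃ y ∈ S, (openGraph ξ).Reachable y z).card with hMS
      set Lx : Fin n → BondConfig (Fin n) → ℕ := fun x ξ => (A.filter fun z => (openGraph ξ).Reachable x z).card with hLx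
      change ν.real {ξ | (∀ y ∈ S, ¬ (openGraph ξ).Reachable p y) ∧ 1 ≤ MS ξ ∧ MS ξ ≤ j} +
          ν.real {ξ | ¬ 1 ≤ MS ξ ∧ Lx c ξ ≤ j} ≤ ν.real {ξ | (∀ y ∈ S, ¬ (openGraph ξ).Reachable p y) ∧ Lx p ξ ≤ j}
      have hMS0 : ∀ ξ, ¬ 1 ≤ MS ξ → ∀ y ∈ S, ¬ (openGraph ξ).Reachable p y := by
        intro ξ h y hy hpy
        exact h (Finset.card_pos.2 ⟨p, Finset.mem_filter.2 ⟨hpA, y, hy, hpy.symm⟩⟩)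
      by_cases hpS : p ∈ S
      · -- `p ∈ S`: `p ≁ S` is impossible and `|π(S)| ≥ 1`
        have h1 : ν.real {ξ | (∀ y ∈ S, ¬ (openGraph ξ).Reachable p y) ∧ 1 ≤ MS ξ ∧ MS ξ ≤ j} = 0 := by
          have : {ξ | (∀ y ∈ S, ¬ (openGraph ξ).Reachable p y) ∧ 1 ≤ MS ξ ∧ MS ξ ≤ j} = (∅ : Set (BondConfig (Fin n))) := by
            ext ξ; simp only [mem_setOf_eq, mem_empty_iff_false, iff_false, not_and]
            intro h; exact absurd (SimpleGraph.Reachable.refl p) (h p hpS)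
          rw [this, measureReal_empty]
        have h2 : ν.real {ξ | ¬ 1 ≤ MS ξ ∧ Lx c ξ ≤ j} = 0 := by
          have : {ξ | ¬ 1 ≤ MS ξ ∧ Lx c ξ ≤ j} = (∅ : Set (BondConfig (Fin n))) := by
            ext ξ; simp only [mem_setOf_eq, mem_empty_iff_false, iff_false, not_and]
            intro h; exact absurd (SimpleGraph.Reachable.refl p) (hMS0 ξ h p hpS)
          rw [this, measureReal_empty]
        rw [h1, h2, add_zero]; exact measureReal_nonneg
      by_cases hdmS : ∃ y ∈ S, sW y ≤ sW p
      · -- #### a member no `u`-lighter than `p`: unguarded stability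
        obtain ⟨y, hyS, hy⟩ := hdmS
        have hpy : p ≠ y := fun h => hpS (h ▸ hyS)
        have hle : ν.real {ξ : BondConfig (Fin n) | (A.filter fun z => (openGraph ξ).Reachable y z).card ≤ j} ≤
            ν.real {ξ : BondConfig (Fin n) | (A.filter fun z => (openGraph ξ).Reachable p z).card ≤ j} := by
          have h := hy
          simp only [hsW] at h
          rw [e1 y, e1 p, measureReal_preimage_avoid, measureReal_preimage_avoid] at h
          exact h
        have key := unguardedStability_of_member u A S hyS hpy j hle
        change ν.real {ξ | (∀ m ∈ S, ¬ (openGraph ξ).Reachable p m) ∧ MS ξ ≤ j} ≤ ν.real {ξ | (∀ m ∈ S, ¬ (openGraph ξ).Reachable p m) ∧ Lx p ξ ≤ j} at key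
        have hdisj : Disjoint {ξ | (∀ y ∈ S, ¬ (openGraph ξ).Reachable p y) ∧ 1 ≤ MS ξ ∧ MS ξ ≤ j} {ξ | ¬ 1 ≤ MS ξ ∧ Lx c ξ ≤ j} := by
          rw [Set.disjoint_left]
          rintro ξ ⟨_, h1, _⟩ ⟨h2, _⟩
          exact h2 h1
        have hsub : {ξ | (∀ y ∈ S, ¬ (openGraph ξ).Reachable p y) ∧ 1 ≤ MS ξ ∧ MS ξ ≤ j} ∪
            {ξ | ¬ 1 ≤ MS ξ ∧ Lx c ξ ≤ j} ⊆ {ξ | (∀ m ∈ S, ¬ (openGraph ξ).Reachable p m) ∧ MS ξ ≤ j} := by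
          rintro ξ (⟨h1, _, h3⟩ | ⟨h1, _⟩)
          · exact ⟨h1, h3⟩
          · exact ⟨hMS0 ξ h1, by show MS ξ ≤ j; omega⟩
        have hu' := measureReal_union hdisj (MeasurableSet.of_discrete (s := {ξ | ¬ 1 ≤ MS ξ ∧ Lx c ξ ≤ j})) (μ := ν)
          (measure_ne_top _ _) (measure_ne_top _ _)
        rw [← hu']
        exact (measureReal_mono hsub (measure_ne_top _ _)).trans key
      · -- #### a LIGHT star of `o` (all members non-relays `u`-lighter than `p`): the induction hypothesis in `u`, ANY size
        push Not at hdmS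
        have hSA : ∀ y ∈ S, y ∉ A := by
          intro y hy hyA
          exact absurd (hpmax y hyA) (not_le.2 (hdmS y hy))
        have hIH := lsp_of_sPlus u A S p c j hpA (ih n u A S p c p j (Or.inl hlt) hCu hpA hc hpA hSne hSA hchampK')
        -- rewrite the IH in `Reachable` form
        have hfiltS : ∀ (ξ : BondConfig (Fin n)), (A.filter fun z => ∃ y ∈ S, (openGraph ξ).Reachable y z) = (A.filter fun z => ∃ y ∈ S, ξ ∈ openConn y z) :=
          fun ξ => Finset.filter_congr fun _ _ => Iff.rfl
        have eL : {ξ : BondConfig (Fin n) | (∀ y ∈ S, ξ ∉ openConn p y) ∧ 1 ≤ (A.filter fun z => ∃ y ∈ S, ξ ∈ openConn y z).card ∧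
              (A.filter fun z => ∃ y ∈ S, ξ ∈ openConn y z).card ≤ j} = {ξ | (∀ y ∈ S, ¬ (openGraph ξ).Reachable p y) ∧ 1 ≤ MS ξ ∧ MS ξ ≤ j} := by
          ext ξ; simp only [mem_setOf_eq, hMS, hfiltS ξ]; exact Iff.rfl
        have eZ : {ξ : BondConfig (Fin n) | ¬ 1 ≤ (A.filter fun z => ∃ y ∈ S, ξ ∈ openConn y z).card ∧
              (A.filter fun z => ξ ∈ openConn c z).card ≤ j} = {ξ | ¬ 1 ≤ MS ξ ∧ Lx c ξ ≤ j} := by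
          ext ξ; simp only [mem_setOf_eq, hMS, hLx, hfiltS ξ, hfilt c ξ]
        have eR : {ξ : BondConfig (Fin n) | (∀ y ∈ S, ξ ∉ openConn p y) ∧ (A.filter fun z => ξ ∈ openConn p z).card ≤ j} =
            {ξ | (∀ y ∈ S, ¬ (openGraph ξ).Reachable p y) ∧ Lx p ξ ≤ j} := by
          ext ξ; simp only [mem_setOf_eq, hLx, hfilt p ξ]; exact Iff.rfl
        rw [eL, eZ, eR] at hIH
        exact hIH
    -- ### from the unrestricted deficit form to S⁺ at the singleton: `μ(Φ_c) = μ(Φ_c ∩ 𝔸) + μ(|π(o)| = 0, Φ_c)`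
    have hsplit := measureReal_inter_add_sdiff (μ := μ) (s := {ω : BondConfig (Fin n) | Nx c ω ≤ j})
      (MeasurableSet.of_discrete (s := {ω : BondConfig (Fin n) | 1 ≤ Nx o ω})) (measure_ne_top _ _)
    have es1 : {ω : BondConfig (Fin n) | Nx c ω ≤ j} ∩ {ω | 1 ≤ Nx o ω} = {ω | Nx c ω ≤ j ∧ 1 ≤ Nx o ω} := by
      ext ω; simp only [mem_inter_iff, mem_setOf_eq]
    have es2 : {ω : BondConfig (Fin n) | Nx c ω ≤ j} \ {ω | 1 ≤ Nx o ω} = {ω | ¬ 1 ≤ NB ω ∧ Nx c ω ≤ j} := by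
      ext ω; simp only [mem_sdiff, mem_setOf_eq, hNo]; exact and_comm
    rw [es1, es2] at hsplit
    have eL : {ω : BondConfig (Fin n) | 1 ≤ NB ω ∧ NB ω ≤ j} = {ω | 1 ≤ Nx o ω ∧ Nx o ω ≤ j} := by ext ω; simp only [mem_setOf_eq, hNo]
    rw [eL]
    have hXZ' : μ.real {ω : BondConfig (Fin n) | 1 ≤ Nx o ω ∧ Nx o ω ≤ j} + μ.real {ω : BondConfig (Fin n) | Nx c ω ≤ j} ≤
        μ.real {ω : BondConfig (Fin n) | Nx c ω ≤ j ∧ 1 ≤ Nx o ω} + μ.real {ω : BondConfig (Fin n) | Nx q ω ≤ j} := hXZ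
    linarith

end Summit.CriticalPhenomena.PercolationContinuityZ3.Theorems

end
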